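import Literature.MathematicalPhysics.QuantumFieldTheory.Balaban1983to89.B4TorusRegionLift

/-!
# `Balaban1983to89.B4TorusPairFam` — THE FAMILY OF TORUS REGION PAIRS `Ω ⊂ Ω₀ ⊂ T_η` AT A (1.7)-REGULAR TORUS
# FIELD FOR [Balaban1983RegularityDecay] THEOREM p. 573, ITS LIFTED LATTICE INSTANCES, AND THE GEOMETRY OF THE
# PERIODIC LIFT (distances, near/far sources, lifted contours)

statement-level skeleton of published theorems with citation tags; proofs where landed; nothing here is a claim about the Yang–Mills mass gap

CITATION HEADER.  T. Bałaban, *Regularity and decay of lattice Green's functions*, Commun. Math. Phys. **89** (1983)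
571–597, doi:10.1007/bf01214744 [Balaban1983RegularityDecay] (cell paper B4; held text
`paper:balaban1983-cmp89-regularity-decay`, journal page = PDF page + 570; p. 572 [PDF 2], p. 573 [PDF 3], p. 580 [PDF 10]).  Unit
`lit-balaban-r01` gen 9 (B4 fold owner; HOME `run/shared/lean/pub/lit-balaban/`), SKELETON rows **B4.Thm@573** /
**B4.Eq1.8** — the torus qualifier «Ω ⊂ T_η at a regular A ≠ 0» — file 3 of the r01 g9 programme
(`B4TorusRegionOp` → `B4TorusRegionLift` → THIS FILE → `B4ThmTorusPairEta`).

WHAT IS PRINTED.  p. 572 [PDF 2], verbatim: «We consider operators on subsets of the lattice ηZ^d, η = L^{−k}. …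
Another common case is to consider operators on subsets of a torus T_η which we identify with a rectangular
parallelepiped in ηZ^d with periodic conditions. … We consider subsets Ω which are unions of big blocks.»  p. 573
[PDF 3]: the Theorem (1.9)–(1.12) «for x, x′ ∈ Ω, and satisfying the condition dist({x, x′}, Ω^c) ≥ R₀ … For some
simple sets Ω, e.g. for rectangular parallelepipeds, the inequalities hold without any restrictions on the points x, x′»,
and (1.8).

WHAT THIS MODULE PROVIDES (definitions with bodies and proved lemmas; NO new `Prop` fact).
* §1 THE PRINTED FUNCTIONALS ON A TORUS REGION `Ω ⊂ T_η` (carrier `fineDom n Ω_T` of representatives, torus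
  sup-metric `tnorm` of `B4TorusRegionOp`): `tsupp`, `tsdist1` = dist_T(x, supp f), `tcdist` = dist_T(x, Ω^c),
  `tbdistS`, `tssdist`, the admissible torus contours `TAdm`, the weight `twt`, the Hölder quotient `tholderQ`; the
  instances `TorusPairInst` and **the family `torusPairFam : TorusPairInst → B4.EtaSetting`** (typed `regular` = (1.7)
  with torus forward differences on `Ω₀`; `bigBlocks` = `Ω₀`, `Ω` and `T_η` are unions of `K`-blocks; `rect` = «`Ω` is
  the whole torus»).
* §2 THE LIFTED LATTICE INSTANCES of `B4ThmRegionPairEta.RegionPairInst`: `liftInst R` (the pair of lifts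
  `Ω̃_R ⊂ Ω̃₀,R` at the periodic field), `liftInst₀ R` (the pair `Ω̃₀,R ⊂ Ω̃₀,R`), `oneInst` (the representatives
  themselves), with the transfer of the typed hypotheses (`regular_lift`, `bigBlocks_lift`, …); the torus
  derivative of a restricted field `fld_torusDeriv_res`.
* §3 GEOMETRY OF THE LIFT: copy indices of blocks `cidx_blk`, the separation of far copies `far_dist`, torus distances
  of reductions `tnorm_twrap_sub_twrap`, short vectors `tnorm_eq_supNorm_of_small`, `abs_cidx_blk_le_one`; NEAR sites
  `Near` and the near part `cutNear` of a source.
* §4 LIFTED CONTOURS: `liftStep`, `liftChain` and `liftChain_spec` (a torus nearest-neighbour chain from `πx̃` lifts to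
  a lattice nearest-neighbour chain from an interior `x̃`, with the same transporter and reductions, staying within
  `|Γ|` of `x̃`).
HONEST SCOPE.  Abelian one-parameter flow (1.2), component fields, the `ℓ^∞` torus metric in unit-lattice units, fine
period `nP_ν ≥ 3` (a field of the instance), `Ω₀ ⊆` the period box of unit labels.  No `sorry`; axioms standard.

v1.1 (unit `lit-balaban-r01` gen 21, 2026-08-22; DOCSTRING-ONLY, every declaration byte-identical): locators of
Corollary 2.3 in the docstrings of `tssdist`, `opXT`, `opX₀T` («Cor. 2.3 p.581», «Cor. 2.3 (2.30) p.581») →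
«Cor. 2.3 (2.30) p.580» — Corollary 2.3 and its display (2.30) are the end of p. 580
[PDF 10]; p. 581 carries only its δG sentence (class P69-008 of the summit-lit1 CITELOC register, found by an own-stem
locator audit against the held text layer); citation-header page list += p. 580.
v1.2 (gen 39, 2026-08-23; DOCSTRING-ONLY, every declaration byte-identical; quotation fidelity, re-read on the page
renders p. 571 / 572 / 573 [PDF 1/2/3] and the held text layer): summit-lit1 Q-FID row QF84-002 — the tag of `tsdist1`
placed the p. 572 words «operators on subsets of a torus T_η» under «(1.10) p.573»; now «(1.10) p.573; p.572 «…»» —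
and, by the same own re-read, two glosses that stood inside quotation marks are replaced by the printed words: the first
sentence of the WHAT IS PRINTED block above (p. 572 prints «We consider operators on subsets of the lattice ηZ^d,
η = L^{−k}.», not «We consider a lattice ηZ^d or its subsets, with η = L^{−k}») and the tag of `TAdm` (p. 573 «let us
denote by Γ_{x,x′} a shortest contour connecting these points»).
-/

namespace Literature.MathematicalPhysics.QuantumFieldTheory.Balaban1983to89.B4TorusPairFam

open Literature.MathematicalPhysics.QuantumFieldTheory.Balaban1983to89.B4 (EtaSetting)
open Literature.MathematicalPhysics.QuantumFieldTheory.Balaban1983to89.B4TorusPositivity (wrap box mem_box wrap_mem_box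
  wrap_eq_self_of_mem wrap_wrap_add)
open Literature.MathematicalPhysics.QuantumFieldTheory.Balaban1983to89.B4Reflection242 (boxDom mem_boxDom nbrs mem_nbrs
  blk blk_mem_boxDom blk_mul supNorm_add_le supNorm_le_of_forall)
open Literature.MathematicalPhysics.QuantumFieldTheory.Balaban1983to89.B4GaugeCovariance
open Literature.MathematicalPhysics.QuantumFieldTheory.Balaban1983to89.B4ContourShift (supNorm supNorm_nonneg
  exists_supNorm_eq abs_le_supNorm)
open Literature.MathematicalPhysics.QuantumFieldTheory.Balaban1983to89.B4TorusKernel (supNorm_neg)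
open Literature.MathematicalPhysics.QuantumFieldTheory.Balaban1983to89.B4Lower18 (fineDom mem_fineDom IsBlockUnion
  fineDom_isBlockUnion supNorm_sub_le_one_of_mem_nbrs)
open Literature.MathematicalPhysics.QuantumFieldTheory.Balaban1983to89.B4Lower18Regular (e1 PathRel transport_fieldLink)
open Literature.MathematicalPhysics.QuantumFieldTheory.Balaban1983to89.B4Lower18RegularRegion (compField)
open Literature.MathematicalPhysics.QuantumFieldTheory.Balaban1983to89.B4Lemma21Region (regionOp regionDeriv siteNorm)
open Literature.MathematicalPhysics.QuantumFieldTheory.Balaban1983to89.B4Lemma22Reduce231 (supN le_supN supN_nonneg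
  supN_le siteNorm_nonneg siteNorm_zero)
open Literature.MathematicalPhysics.QuantumFieldTheory.Balaban1983to89.B4Lemma22HolderBox (IsNNChain)
open Literature.MathematicalPhysics.QuantumFieldTheory.Balaban1983to89.B4RegionCubeCarrier (incl fineDom_mono)
open Literature.MathematicalPhysics.QuantumFieldTheory.Balaban1983to89.B4ThmRegionPairEta (RegionPairInst regionPairFam)
open Literature.MathematicalPhysics.QuantumFieldTheory.Balaban1983to89.B4TorusRegionOp
open Literature.MathematicalPhysics.QuantumFieldTheory.Balaban1983to89.B4TorusRegionLift
open scoped Matrix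

noncomputable section

variable {d : ℕ} {ι : Type} [Fintype ι] [DecidableEq ι]

/-! ## §1. The printed functionals on a torus region; the instances; the family -/

section Functionals

variable {n : ℕ} (P : Fin (d + 1) → ℕ) {ΩT : Finset (Fin (d + 1) → ℤ)}

/-- the support of a source on a torus region, as a set of sites. [cite: Balaban1983RegularityDecay, (1.9) p.573 «supp f», dictionary] -/
def tsupp (f : ↥(fineDom n ΩT) × ι → ℝ) : Finset ↥(fineDom n ΩT) :=
  open Classical in Finset.univ.filter fun z => ∃ j, f (z, j) ≠ 0

/-- `dist_T(x, supp f)`: torus sup-metric, unit-lattice units (`0` for `f = 0`). [cite: Balaban1983RegularityDecay, (1.10) p.573; p.572 «operators on subsets of a torus T_η»; dictionary] -/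
def tsdist1 (x : ↥(fineDom n ΩT)) (f : ↥(fineDom n ΩT) × ι → ℝ) : ℝ :=
  if h : (tsupp f).Nonempty then (tsupp f).inf' h (fun z => tnorm n P (x.1 - z.1) / (n : ℝ)) else 0

/-- **`dist_T(x, Ω^c)`**: the infimum of the torus sup-distance (unit-lattice units) over the fine torus points outside
`Ω` (`0` when `Ω` is the whole torus). [cite: Balaban1983RegularityDecay, Theorem p.573 «dist(x, Ω^c) ≥ R₀», dictionary] -/
def tcdist (x : ↥(fineDom n ΩT)) : ℝ :=
  if h : (boxDom (per n P) \ fineDom n ΩT).Nonempty then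
    (boxDom (per n P) \ fineDom n ΩT).inf' h (fun z => tnorm n P (x.1 - z) / (n : ℝ))
  else 0

/-- `dist_T(supp f, Ω^c)` (`0` for `f = 0`). [cite: Balaban1983RegularityDecay, (1.12) p.573, dictionary] -/
def tbdistS (f : ↥(fineDom n ΩT) × ι → ℝ) : ℝ :=
  if h : (tsupp f).Nonempty then (tsupp f).inf' h (fun z => tcdist P z) else 0

/-- `dist_T(supp f, supp f′)` (Corollary 2.3's datum; `0` if a support is empty). [cite: Balaban1983RegularityDecay, Cor. 2.3 (2.30) p.580, dictionary] -/
def tssdist (f f' : ↥(fineDom n ΩT) × ι → ℝ) : ℝ :=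
  if h : (tsupp f ×ˢ tsupp f').Nonempty then
    (tsupp f ×ˢ tsupp f').inf' h (fun p => tnorm n P (p.1.1 - p.2.1) / (n : ℝ))
  else 0

/-- THE ADMISSIBLE TORUS CONTOURS `Γ_{x,x′}` for the Hölder quotient in direction `μ`: the torus bonds `⟨x,x+ηe_μ⟩`,
`⟨x′,x′+ηe_μ⟩` lie in `Ω`, `x′ ≠ x`, and `Γ` is a chain of torus bonds of `Ω` from `x` to `x′` with
`|Γ| ≤ (d+1)|x′−x|_T` inside the `|x′−x|_T`-ball about `x` (every shortest torus staircase inside `Ω` is one).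
[cite: Balaban1983RegularityDecay, p.573 «let us denote by Γ_{x,x′} a shortest contour connecting these points», dictionary] -/
def TAdm (μ : Fin (d + 1)) (x x' : ↥(fineDom n ΩT)) (l : List ↥(fineDom n ΩT)) : Prop :=
  twrap n P (x.1 + e1 μ) ∈ fineDom n ΩT ∧ twrap n P (x'.1 + e1 μ) ∈ fineDom n ΩT ∧ x'.1 ≠ x.1 ∧
    PathRel (fun u v : ↥(fineDom n ΩT) => TNbr n P u.1 v.1) x l ∧ pathEnd x l = x' ∧
    (l.length : ℝ) ≤ ((d : ℝ) + 1) * tnorm n P (x'.1 - x.1) ∧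
    ∀ z ∈ l, tnorm n P (z.1 - x.1) ≤ tnorm n P (x'.1 - x.1)

/-- the Hölder weight `|x − x′|_T^{-α}` in `η`-units: `(n/|x′−x|_T)^α`. [cite: Balaban1983RegularityDecay, (1.9) p.573, dictionary] -/
def twt (α : ℝ) (x x' : ↥(fineDom n ΩT)) : ℝ := ((n : ℝ) / tnorm n P (x'.1 - x.1)) ^ α

/-- THE HÖLDER QUOTIENT of a field `v` between `x` and `x′` in direction `μ` on a torus region at the torus field `A`
(coupling `eη`): `sup_Γ |x−x′|_T^{-α}|U(A(Γ))v(x′) − v(x)|` over the admissible torus contours (`0` if there is none).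
[cite: Balaban1983RegularityDecay, (1.9) p.573] -/
def tholderQ (F : OrthFlow ι) (κ : ℝ) (Ac : (Fin (d + 1) → ℤ) → Fin (d + 1) → ℝ) (α : ℝ) (μ : Fin (d + 1))
    (v : ↥(fineDom n ΩT) × ι → ℝ) (x x' : ↥(fineDom n ΩT)) : ℝ :=
  ⨆ (l : List ↥(fineDom n ΩT)), ⨆ (_ : TAdm P μ x x' l),
    twt P α x x' * siteNorm (transport (fieldLink F κ fun a b : ↥(fineDom n ΩT) => torBond n P Ac a.1 b.1) x l
      *ᵥ fld v x' - fld v x)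

/-- a bound on every admissible quotient bounds the Hölder quotient. [cite: Balaban1983RegularityDecay, (1.9) p.573, dictionary] -/
theorem tholderQ_le (F : OrthFlow ι) (κ : ℝ) (Ac : (Fin (d + 1) → ℤ) → Fin (d + 1) → ℝ) {α : ℝ} {μ : Fin (d + 1)}
    {v : ↥(fineDom n ΩT) × ι → ℝ} {x x' : ↥(fineDom n ΩT)} {b : ℝ} (hb : 0 ≤ b)
    (h : ∀ l, TAdm P μ x x' l →
      twt P α x x' * siteNorm (transport (fieldLink F κ fun a b : ↥(fineDom n ΩT) => torBond n P Ac a.1 b.1) x l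
        *ᵥ fld v x' - fld v x) ≤ b) :
    tholderQ P F κ Ac α μ v x x' ≤ b :=
  Real.iSup_le (fun l => Real.iSup_le (fun hl => h l hl) hb) hb

omit [DecidableEq ι] in
/-- off the support the source vanishes. [cite: Balaban1983RegularityDecay, (1.9) p.573, dictionary] -/
theorem eq_zero_of_not_mem_tsupp (f : ↥(fineDom n ΩT) × ι → ℝ) (p : ↥(fineDom n ΩT) × ι) (hp : p.1 ∉ tsupp f) :
    f p = 0 := by
  classical
  by_contra h
  exact hp (by unfold tsupp; exact Finset.mem_filter.mpr ⟨Finset.mem_univ _, p.2, h⟩)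

omit [DecidableEq ι] in
/-- a site carrying a non-zero component lies in the support. [cite: Balaban1983RegularityDecay, (1.9) p.573, dictionary] -/
theorem mem_tsupp_of_ne (f : ↥(fineDom n ΩT) × ι → ℝ) {z : ↥(fineDom n ΩT)} {j : ι} (h : f (z, j) ≠ 0) :
    z ∈ tsupp f := by
  classical
  unfold tsupp; exact Finset.mem_filter.mpr ⟨Finset.mem_univ _, j, h⟩

omit [DecidableEq ι] in
/-- `dist_T(x, supp f) ≤ |x − z|_T/n` for `z ∈ supp f`. [cite: Balaban1983RegularityDecay, (1.10) p.573, dictionary] -/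
theorem tsdist1_le (x : ↥(fineDom n ΩT)) (f : ↥(fineDom n ΩT) × ι → ℝ) {z : ↥(fineDom n ΩT)} (hz : z ∈ tsupp f) :
    tsdist1 P x f ≤ tnorm n P (x.1 - z.1) / (n : ℝ) := by
  unfold tsdist1
  rw [dif_pos ⟨z, hz⟩]
  exact Finset.inf'_le _ hz

omit [DecidableEq ι] in
/-- `dist_T(x, supp f) ≥ 0`. [cite: Balaban1983RegularityDecay, (1.10) p.573, dictionary] -/
theorem tsdist1_nonneg (x : ↥(fineDom n ΩT)) (f : ↥(fineDom n ΩT) × ι → ℝ) : 0 ≤ tsdist1 P x f := by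
  unfold tsdist1
  split_ifs with h
  · exact Finset.le_inf' _ _ fun z _ => div_nonneg (tnorm_nonneg _ _ _) (Nat.cast_nonneg _)
  · exact le_rfl

omit [Fintype ι] [DecidableEq ι] in
/-- `dist_T(x, Ω^c) ≤ |x − z|_T/n` for a fine torus point `z ∉ Ω`. [cite: Balaban1983RegularityDecay, Theorem p.573 «dist(x, Ω^c)», dictionary] -/
theorem tcdist_le (x : ↥(fineDom n ΩT)) {z : Fin (d + 1) → ℤ} (hz : z ∈ boxDom (per n P)) (hz' : z ∉ fineDom n ΩT) :
    tcdist P x ≤ tnorm n P (x.1 - z) / (n : ℝ) := by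
  have hm : z ∈ boxDom (per n P) \ fineDom n ΩT := Finset.mem_sdiff.2 ⟨hz, hz'⟩
  unfold tcdist
  rw [dif_pos ⟨z, hm⟩]
  exact Finset.inf'_le _ hm

omit [Fintype ι] [DecidableEq ι] in
/-- `dist_T(x, Ω^c) ≥ 0`. [cite: Balaban1983RegularityDecay, Theorem p.573, dictionary] -/
theorem tcdist_nonneg (x : ↥(fineDom n ΩT)) : 0 ≤ tcdist P x := by
  unfold tcdist
  split_ifs with h
  · exact Finset.le_inf' _ _ fun z _ => div_nonneg (tnorm_nonneg _ _ _) (Nat.cast_nonneg _)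
  · exact le_rfl

omit [Fintype ι] [DecidableEq ι] in
/-- when `Ω` is the whole torus, `dist_T(x, Ω^c) = 0` (empty complement). [cite: Balaban1983RegularityDecay, Theorem p.573 «without any restrictions», dictionary] -/
theorem tcdist_of_rect (hrect : fineDom n ΩT = boxDom (per n P)) (x : ↥(fineDom n ΩT)) : tcdist P x = 0 := by
  unfold tcdist
  rw [dif_neg]
  rw [hrect, Finset.sdiff_self]
  exact Finset.not_nonempty_empty

omit [DecidableEq ι] in
/-- `dist_T(supp f, Ω^c) ≤ dist_T(z, Ω^c)` for `z ∈ supp f`. [cite: Balaban1983RegularityDecay, (1.12) p.573, dictionary] -/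
theorem tbdistS_le (f : ↥(fineDom n ΩT) × ι → ℝ) {z : ↥(fineDom n ΩT)} (hz : z ∈ tsupp f) :
    tbdistS P f ≤ tcdist P z := by
  unfold tbdistS
  rw [dif_pos ⟨z, hz⟩]
  exact Finset.inf'_le _ hz

omit [DecidableEq ι] in
/-- `dist_T(supp f, Ω^c) ≥ 0`. [cite: Balaban1983RegularityDecay, (1.12) p.573, dictionary] -/
theorem tbdistS_nonneg (f : ↥(fineDom n ΩT) × ι → ℝ) : 0 ≤ tbdistS P f := by
  unfold tbdistS
  split_ifs with h
  · exact Finset.le_inf' _ _ fun z _ => tcdist_nonneg P z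
  · exact le_rfl

end Functionals

/-- AN INSTANCE: a scale `k ≥ 1` (`η = (ℓ+1)^{-k}`), a torus `T_η = Π_ν ℤ/(nP_ν)` of `P_ν ≥ 1` unit blocks per direction
and fine period `nP_ν ≥ 3`, a pair `Ω ⊆ Ω₀ ⊆ T_η` of sets of unit labels (representatives in the period box
`Π_ν [0,P_ν)`), `(a, m²)` in the windows, a torus vector field in component form `A_ν(x)` (read on the period box of the
fine torus) and a coupling `e`. [cite: Balaban1983RegularityDecay, p.572 «operators on subsets of a torus T_η», Theorem p.573] -/
structure TorusPairInst (d ℓ : ℕ) (amin aplus m2plus : ℝ) where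
  /-- the scale -/
  k : ℕ
  hk : 1 ≤ k
  /-- the torus: `P_ν` unit blocks in direction `ν` -/
  P : Fin (d + 1) → ℕ
  hP : ∀ ν, 1 ≤ P ν
  h3 : ∀ ν, 3 ≤ per ((ℓ + 1) ^ k) P ν
  /-- the unit labels of `Ω₀` and `Ω` (representatives) -/
  Ω₀T : Finset (Fin (d + 1) → ℤ)
  ΩT : Finset (Fin (d + 1) → ℤ)
  hbox : Ω₀T ⊆ boxDom P
  hsub : ΩT ⊆ Ω₀T
  /-- the averaging weight `a` and the mass `m²` -/
  a : ℝ
  m2 : ℝ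
  ha1 : amin ≤ a
  ha2 : a ≤ aplus
  hm1 : 0 ≤ m2
  hm2 : m2 ≤ m2plus
  /-- the torus component field `A_ν(x)` on the period box of the fine torus -/
  Ac : (Fin (d + 1) → ℤ) → Fin (d + 1) → ℝ
  /-- the coupling -/
  e : ℝ

namespace TorusPairInst

variable {ℓ : ℕ} {amin aplus m2plus : ℝ} (i : TorusPairInst d ℓ amin aplus m2plus)

/-- `Ω`'s labels lie in the period box. [cite: Balaban1983RegularityDecay, p.572, dictionary] -/
theorem hboxΩ : i.ΩT ⊆ boxDom i.P := i.hsub.trans i.hbox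

/-- the coupling at scale `η`: `eη = e/n`. [cite: Balaban1983RegularityDecay, (1.2) p.572, dictionary] -/
abbrev κ : ℝ := i.e / ((ℓ + 1) ^ i.k : ℕ)

/-- the running averaging coefficient `a_k`. [cite: Balaban1983RegularityDecay, (1.6) p.572 «a is a positive constant», dictionary] -/
abbrev aK : ℝ := B1.aSeq i.a ((ℓ : ℝ) + 1) i.k

variable (F : OrthFlow ι)

/-- `H = −Δ + m² + a_kP_k(A)` (1.6) on the torus region `Ω`. [cite: Balaban1983RegularityDecay, (1.6) p.572 «operators on subsets of a torus T_η»] -/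
abbrev HT : Matrix (↥(fineDom ((ℓ + 1) ^ i.k) i.ΩT) × ι) (↥(fineDom ((ℓ + 1) ^ i.k) i.ΩT) × ι) ℝ :=
  torusOp F i.e (Nat.one_le_pow i.k (ℓ + 1) (Nat.succ_pos ℓ)) i.aK i.m2 i.P i.ΩT i.Ac

/-- `H` (1.6) on the torus region `Ω₀`. [cite: Balaban1983RegularityDecay, (1.6) p.572] -/
abbrev H₀T : Matrix (↥(fineDom ((ℓ + 1) ^ i.k) i.Ω₀T) × ι) (↥(fineDom ((ℓ + 1) ^ i.k) i.Ω₀T) × ι) ℝ :=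
  torusOp F i.e (Nat.one_le_pow i.k (ℓ + 1) (Nat.succ_pos ℓ)) i.aK i.m2 i.P i.Ω₀T i.Ac

/-- `G_k(Ω, A)` (1.6) on the torus region `Ω`. [cite: Balaban1983RegularityDecay, (1.6) p.572 «operators on subsets of a torus T_η»] -/
abbrev GT : Matrix (↥(fineDom ((ℓ + 1) ^ i.k) i.ΩT) × ι) (↥(fineDom ((ℓ + 1) ^ i.k) i.ΩT) × ι) ℝ := (i.HT F)⁻¹

/-- `G_k(Ω₀, A)` (1.6) on the torus region `Ω₀`. [cite: Balaban1983RegularityDecay, (1.6) p.572] -/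
abbrev G₀T : Matrix (↥(fineDom ((ℓ + 1) ^ i.k) i.Ω₀T) × ι) (↥(fineDom ((ℓ + 1) ^ i.k) i.Ω₀T) × ι) ℝ := (i.H₀T F)⁻¹

/-- `D^η_{A,μ}` (1.3) on the torus region `Ω`. [cite: Balaban1983RegularityDecay, (1.3) p.572] -/
abbrev DT (μ : Fin (d + 1)) : Matrix (↥(fineDom ((ℓ + 1) ^ i.k) i.ΩT) × ι) (↥(fineDom ((ℓ + 1) ^ i.k) i.ΩT) × ι) ℝ :=
  torusDeriv F i.e ((ℓ + 1) ^ i.k) i.P i.ΩT i.Ac μ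

/-- `D^η_{A,μ}` (1.3) on the torus region `Ω₀`. [cite: Balaban1983RegularityDecay, (1.3) p.572] -/
abbrev D₀T (μ : Fin (d + 1)) : Matrix (↥(fineDom ((ℓ + 1) ^ i.k) i.Ω₀T) × ι) (↥(fineDom ((ℓ + 1) ^ i.k) i.Ω₀T) × ι) ℝ :=
  torusDeriv F i.e ((ℓ + 1) ^ i.k) i.P i.Ω₀T i.Ac μ

/-- extension by zero `E : (Ω → ℝ^N) → (Ω₀ → ℝ^N)`. [cite: Balaban1983RegularityDecay, (1.11) p.573, dictionary] -/
def extT (f : ↥(fineDom ((ℓ + 1) ^ i.k) i.ΩT) × ι → ℝ) : ↥(fineDom ((ℓ + 1) ^ i.k) i.Ω₀T) × ι → ℝ :=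
  fun p => if h : blk ((ℓ + 1) ^ i.k) p.1.1 ∈ i.ΩT then f (⟨p.1.1, (mem_fineDom (Nat.one_le_pow i.k (ℓ + 1) (Nat.succ_pos ℓ))).2 h⟩, p.2) else 0

/-- restriction `(Ω₀ → ℝ^N) → (Ω → ℝ^N)`. [cite: Balaban1983RegularityDecay, (1.11) p.573, dictionary] -/
def resT (g : ↥(fineDom ((ℓ + 1) ^ i.k) i.Ω₀T) × ι → ℝ) : ↥(fineDom ((ℓ + 1) ^ i.k) i.ΩT) × ι → ℝ :=
  fun q => g (incl (Nat.one_le_pow i.k (ℓ + 1) (Nat.succ_pos ℓ)) i.hsub q.1, q.2)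

/-- `δG_k(Ω,Ω₀,A)f = G_k(Ω,A)f − (G_k(Ω₀,A)Ef)|Ω` (1.11) on the torus. [cite: Balaban1983RegularityDecay, (1.11) p.573] -/
abbrev deltaT (f : ↥(fineDom ((ℓ + 1) ^ i.k) i.ΩT) × ι → ℝ) : ↥(fineDom ((ℓ + 1) ^ i.k) i.ΩT) × ι → ℝ :=
  i.GT F *ᵥ f - i.resT (i.G₀T F *ᵥ i.extT f)

/-- the four vectors `Gf`, `D_μGf`, `GD_ν^*f`, `D_μGD_ν^*f` of (2.15)/(2.30) on the torus region `Ω`.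
[cite: Balaban1983RegularityDecay, (2.15) p.577, Cor. 2.3 (2.30) p.580, dictionary] -/
def opXT (m : Fin 4) (μ ν : Fin (d + 1)) (f : ↥(fineDom ((ℓ + 1) ^ i.k) i.ΩT) × ι → ℝ) :
    ↥(fineDom ((ℓ + 1) ^ i.k) i.ΩT) × ι → ℝ :=
  if m = 0 then i.GT F *ᵥ f else if m = 1 then i.DT F μ *ᵥ (i.GT F *ᵥ f)
  else if m = 2 then (i.GT F * (i.DT F ν)ᵀ) *ᵥ f else i.DT F μ *ᵥ ((i.GT F * (i.DT F ν)ᵀ) *ᵥ f)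

/-- the same four vectors on `Ω₀`. [cite: Balaban1983RegularityDecay, (2.15) p.577, Cor. 2.3 (2.30) p.580, dictionary] -/
def opX₀T (m : Fin 4) (μ ν : Fin (d + 1)) (f : ↥(fineDom ((ℓ + 1) ^ i.k) i.Ω₀T) × ι → ℝ) :
    ↥(fineDom ((ℓ + 1) ^ i.k) i.Ω₀T) × ι → ℝ :=
  if m = 0 then i.G₀T F *ᵥ f else if m = 1 then i.D₀T F μ *ᵥ (i.G₀T F *ᵥ f)
  else if m = 2 then (i.G₀T F * (i.D₀T F ν)ᵀ) *ᵥ f else i.D₀T F μ *ᵥ ((i.G₀T F * (i.D₀T F ν)ᵀ) *ᵥ f)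

end TorusPairInst

/-- **THE FAMILY OF SETTINGS OF THE THEOREM ON TORUS REGION PAIRS `Ω ⊂ Ω₀ ⊂ T_η` AT A (1.7)-REGULAR TORUS FIELD**:
b04's `B4.EtaSetting` filled with the printed objects on the torus region `Ω` (distances in the torus sup-metric,
unit-lattice units; `regular` = (1.7) on `Ω₀` with the torus forward differences `A_ν(x + ηe_μ mod T) − A_ν(x)`;
`bigBlocks` = `Ω₀`, `Ω` AND the torus are unions of `K`-blocks (`K ∣ P_ν`); `rect` = «`Ω` is the whole torus» — p. 572
identifies `T_η` with «a rectangular parallelepiped … with periodic conditions», for which the print waives the `R₀`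
restriction).  Parameters: the flow, `d`, `ℓ` (`L = ℓ+1`), the windows, the (1.7) constants `(c, β)`, the big-block
size `K`. [cite: Balaban1983RegularityDecay, (1.7) p.572, Theorem (1.9)–(1.12) p.573, p.572 «operators on subsets of a torus T_η»] -/
def torusPairFam (F : OrthFlow ι) (d ℓ : ℕ) (amin aplus m2plus creg β : ℝ) (K : ℕ)
    (i : TorusPairInst d ℓ amin aplus m2plus) : EtaSetting where
  Site := ↥(fineDom ((ℓ + 1) ^ i.k) i.ΩT)
  Dir := Fin (d + 1)
  Src := ↥(fineDom ((ℓ + 1) ^ i.k) i.ΩT) × ι → ℝ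
  e := i.e
  regular := ∀ x ∈ fineDom ((ℓ + 1) ^ i.k) i.Ω₀T, ∀ μ ν : Fin (d + 1),
    |i.Ac (twrap ((ℓ + 1) ^ i.k) i.P (x + e1 μ)) ν - i.Ac x ν| ≤ creg * i.e ^ (β - 1) / ((ℓ + 1) ^ i.k : ℕ)
  bigBlocks := IsBlockUnion K i.Ω₀T ∧ IsBlockUnion K i.ΩT ∧ ∀ ν, K ∣ i.P ν
  rect := fineDom ((ℓ + 1) ^ i.k) i.ΩT = boxDom (per ((ℓ + 1) ^ i.k) i.P)
  pdist := fun x y => tnorm ((ℓ + 1) ^ i.k) i.P (x.1 - y.1) / (((ℓ + 1) ^ i.k : ℕ) : ℝ)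
  sdist1 := fun x f => tsdist1 i.P x f
  sdist2 := fun x x' f => min (tsdist1 i.P x f) (tsdist1 i.P x' f)
  bdist1 := fun x => tcdist i.P x
  bdist2 := fun x x' => min (tcdist i.P x) (tcdist i.P x')
  bdistS := fun f => tbdistS i.P f
  supNorm := fun f => supN f
  l2Norm := fun f => Real.sqrt (∑ p, f p ^ 2)
  ssdist := fun f f' => tssdist i.P f f'
  lhs19 := fun α μ f x x' => tholderQ i.P F i.κ i.Ac α μ (i.DT F μ *ᵥ (i.GT F *ᵥ f)) x x'
  valDG := fun μ f x => siteNorm (fld (i.DT F μ *ᵥ (i.GT F *ᵥ f)) x)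
  valG := fun f x => siteNorm (fld (i.GT F *ᵥ f) x)
  dlhs19 := fun α μ f x x' => tholderQ i.P F i.κ i.Ac α μ (i.DT F μ *ᵥ i.deltaT F f) x x'
  dvalDG := fun μ f x => siteNorm (fld (i.DT F μ *ᵥ i.deltaT F f) x)
  dvalG := fun f x => siteNorm (fld (i.deltaT F f) x)
  lower18 := fun γ => ∀ v : ↥(fineDom ((ℓ + 1) ^ i.k) i.ΩT) × ι → ℝ, γ * (v ⬝ᵥ v) ≤ v ⬝ᵥ (i.HT F *ᵥ v)
  pair := fun m μ ν f' f => |f' ⬝ᵥ i.opXT F m μ ν f|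
  dpair := fun m μ ν f' f => |f' ⬝ᵥ (i.opXT F m μ ν f - i.resT (i.opX₀T F m μ ν (i.extT f)))|

/-! ## §2. The lifted lattice instances; transfer of the typed hypotheses; restriction and the torus derivative -/

namespace TorusPairInst

variable {ℓ : ℕ} {amin aplus m2plus : ℝ} (i : TorusPairInst d ℓ amin aplus m2plus)

/-- **THE LIFTED LATTICE INSTANCE** `Ω̃_R ⊂ Ω̃₀,R ⊂ ηℤ^{d+1}` of `B4ThmRegionPairEta`: the `(2R+1)^{d+1}` copies of
`Ω ⊆ Ω₀` at the periodic field, same scale, windows and coupling. [cite: Balaban1983RegularityDecay, p.572 «periodic conditions», dictionary] -/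
def liftInst (R : ℕ) : RegionPairInst d ℓ amin aplus m2plus where
  k := i.k
  hk := i.hk
  Ω₀c := liftLabels i.P R i.Ω₀T
  Ωc := liftLabels i.P R i.ΩT
  hsub := liftLabels_mono R i.hsub
  a := i.a
  m2 := i.m2
  ha1 := i.ha1
  ha2 := i.ha2
  hm1 := i.hm1
  hm2 := i.hm2
  Ac := perField ((ℓ + 1) ^ i.k) i.P i.Ac
  e := i.e

/-- THE LIFTED INSTANCE `Ω̃₀,R ⊂ Ω̃₀,R` (for the values of `G_k(Ω₀, A)` alone). [cite: Balaban1983RegularityDecay, p.572 «periodic conditions», dictionary] -/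
def liftInst₀ (R : ℕ) : RegionPairInst d ℓ amin aplus m2plus where
  k := i.k
  hk := i.hk
  Ω₀c := liftLabels i.P R i.Ω₀T
  Ωc := liftLabels i.P R i.Ω₀T
  hsub := Finset.Subset.refl _
  a := i.a
  m2 := i.m2
  ha1 := i.ha1
  ha2 := i.ha2
  hm1 := i.hm1
  hm2 := i.hm2
  Ac := perField ((ℓ + 1) ^ i.k) i.P i.Ac
  e := i.e

/-- THE ONE-COPY INSTANCE: the representatives `Ω ⊆ Ω₀ ⊂ ηℤ^{d+1}` themselves at the periodic field (for (1.8)).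
[cite: Balaban1983RegularityDecay, p.572 «a rectangular parallelepiped in ηZ^d with periodic conditions», dictionary] -/
def oneInst : RegionPairInst d ℓ amin aplus m2plus where
  k := i.k
  hk := i.hk
  Ω₀c := i.Ω₀T
  Ωc := i.ΩT
  hsub := i.hsub
  a := i.a
  m2 := i.m2
  ha1 := i.ha1
  ha2 := i.ha2
  hm1 := i.hm1
  hm2 := i.hm2
  Ac := perField ((ℓ + 1) ^ i.k) i.P i.Ac
  e := i.e

/-- **(1.7) TRANSFERS**: the torus field is regular on `Ω₀` only if its periodic extension is regular on the lift of
`Ω₀`. [cite: Balaban1983RegularityDecay, (1.7) p.572] -/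
theorem regular_lift (F : OrthFlow ι) {creg β : ℝ} {K : ℕ} (R : ℕ)
    (h : (torusPairFam F d ℓ amin aplus m2plus creg β K i).regular) :
    (regionPairFam F d ℓ amin aplus m2plus creg β K (i.liftInst R)).regular := by
  dsimp only [torusPairFam, regionPairFam, liftInst] at h ⊢
  intro x hx μ ν
  have hxT : twrap ((ℓ + 1) ^ i.k) i.P x ∈ fineDom ((ℓ + 1) ^ i.k) i.Ω₀T :=
    ((mem_fineDom_lift_iff (Nat.one_le_pow i.k (ℓ + 1) (Nat.succ_pos ℓ)) i.hP i.hbox).1 hx).1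
  have h' := h _ hxT μ ν
  simp only [perField, twrap_twrap_add] at h' ⊢
  exact h'

/-- (1.7) transfers to the instance `Ω̃₀,R ⊂ Ω̃₀,R`. [cite: Balaban1983RegularityDecay, (1.7) p.572] -/
theorem regular_lift₀ (F : OrthFlow ι) {creg β : ℝ} {K : ℕ} (R : ℕ)
    (h : (torusPairFam F d ℓ amin aplus m2plus creg β K i).regular) :
    (regionPairFam F d ℓ amin aplus m2plus creg β K (i.liftInst₀ R)).regular :=
  i.regular_lift F R h

/-- (1.7) transfers to the one-copy instance. [cite: Balaban1983RegularityDecay, (1.7) p.572] -/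
theorem regular_one (F : OrthFlow ι) {creg β : ℝ} {K : ℕ}
    (h : (torusPairFam F d ℓ amin aplus m2plus creg β K i).regular) :
    (regionPairFam F d ℓ amin aplus m2plus creg β K i.oneInst).regular := by
  dsimp only [torusPairFam, regionPairFam, oneInst] at h ⊢
  intro x hx μ ν
  have h' := h x hx μ ν
  have hx' : twrap ((ℓ + 1) ^ i.k) i.P x = x := twrap_eq_self (val_mem_perBox (Nat.one_le_pow i.k (ℓ + 1) (Nat.succ_pos ℓ)) i.hbox ⟨x, hx⟩)
  simp only [perField]
  rw [hx']
  exact h'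

/-- **«UNIONS OF BIG BLOCKS» TRANSFERS** to the lift (`K ∣ P_ν`). [cite: Balaban1983RegularityDecay, p.572 «Ω … unions of big blocks»] -/
theorem bigBlocks_lift (F : OrthFlow ι) {creg β : ℝ} {K : ℕ} (hK : 1 ≤ K) (R : ℕ)
    (h : (torusPairFam F d ℓ amin aplus m2plus creg β K i).bigBlocks) :
    (regionPairFam F d ℓ amin aplus m2plus creg β K (i.liftInst R)).bigBlocks := by
  dsimp only [torusPairFam, regionPairFam, liftInst] at h ⊢
  obtain ⟨h₀, h₁, hKP⟩ := h
  exact ⟨isBlockUnion_liftLabels hK hKP h₀ R, isBlockUnion_liftLabels hK hKP h₁ R⟩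

/-- «unions of big blocks» transfers to the instance `Ω̃₀,R ⊂ Ω̃₀,R`. [cite: Balaban1983RegularityDecay, p.572 «Ω … unions of big blocks»] -/
theorem bigBlocks_lift₀ (F : OrthFlow ι) {creg β : ℝ} {K : ℕ} (hK : 1 ≤ K) (R : ℕ)
    (h : (torusPairFam F d ℓ amin aplus m2plus creg β K i).bigBlocks) :
    (regionPairFam F d ℓ amin aplus m2plus creg β K (i.liftInst₀ R)).bigBlocks := by
  dsimp only [torusPairFam, regionPairFam, liftInst₀] at h ⊢
  obtain ⟨h₀, -, hKP⟩ := h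
  exact ⟨isBlockUnion_liftLabels hK hKP h₀ R, isBlockUnion_liftLabels hK hKP h₀ R⟩

variable (F : OrthFlow ι)

omit [Fintype ι] [DecidableEq ι] in
/-- restriction evaluated at a site. [cite: Balaban1983RegularityDecay, (1.11) p.573, dictionary] -/
theorem fld_resT (g : ↥(fineDom ((ℓ + 1) ^ i.k) i.Ω₀T) × ι → ℝ) (x : ↥(fineDom ((ℓ + 1) ^ i.k) i.ΩT)) :
    fld (i.resT g) x = fld g (incl (Nat.one_le_pow i.k (ℓ + 1) (Nat.succ_pos ℓ)) i.hsub x) := rfl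

omit [Fintype ι] [DecidableEq ι] in
/-- the extension vanishes off `Ω`. [cite: Balaban1983RegularityDecay, (1.11) p.573, dictionary] -/
theorem extT_of_not_mem (f : ↥(fineDom ((ℓ + 1) ^ i.k) i.ΩT) × ι → ℝ)
    (p : ↥(fineDom ((ℓ + 1) ^ i.k) i.Ω₀T) × ι) (hp : blk ((ℓ + 1) ^ i.k) p.1.1 ∉ i.ΩT) : i.extT f p = 0 := by
  simp only [extT, dif_neg hp]

omit [Fintype ι] [DecidableEq ι] in
/-- the extension at a site of `Ω`. [cite: Balaban1983RegularityDecay, (1.11) p.573, dictionary] -/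
theorem extT_of_mem (f : ↥(fineDom ((ℓ + 1) ^ i.k) i.ΩT) × ι → ℝ)
    (p : ↥(fineDom ((ℓ + 1) ^ i.k) i.Ω₀T) × ι) (hp : blk ((ℓ + 1) ^ i.k) p.1.1 ∈ i.ΩT) :
    i.extT f p = f (⟨p.1.1, (mem_fineDom (Nat.one_le_pow i.k (ℓ + 1) (Nat.succ_pos ℓ))).2 hp⟩, p.2) := by
  simp only [extT, dif_pos hp]

/-- **THE TORUS DERIVATIVE OF A RESTRICTED FIELD** is the restriction of the derivative on `Ω₀`, on a torus bond of
`Ω`. [cite: Balaban1983RegularityDecay, (1.3) p.572, (1.11) p.573, dictionary] -/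
theorem fld_DT_resT (μ : Fin (d + 1)) (w : ↥(fineDom ((ℓ + 1) ^ i.k) i.Ω₀T) × ι → ℝ)
    (x : ↥(fineDom ((ℓ + 1) ^ i.k) i.ΩT))
    (hx : twrap ((ℓ + 1) ^ i.k) i.P (x.1 + e1 μ) ∈ fineDom ((ℓ + 1) ^ i.k) i.ΩT) :
    fld (i.DT F μ *ᵥ i.resT w) x = fld (i.D₀T F μ *ᵥ w) (incl (Nat.one_le_pow i.k (ℓ + 1) (Nat.succ_pos ℓ)) i.hsub x) := by
  have hx' : twrap ((ℓ + 1) ^ i.k) i.P ((incl (Nat.one_le_pow i.k (ℓ + 1) (Nat.succ_pos ℓ)) i.hsub x).1 + e1 μ) ∈ fineDom ((ℓ + 1) ^ i.k) i.Ω₀T :=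
    fineDom_mono (Nat.one_le_pow i.k (ℓ + 1) (Nat.succ_pos ℓ)) i.hsub hx
  show fld (torusDeriv F i.e ((ℓ + 1) ^ i.k) i.P i.ΩT i.Ac μ *ᵥ i.resT w) x
    = fld (torusDeriv F i.e ((ℓ + 1) ^ i.k) i.P i.Ω₀T i.Ac μ *ᵥ w) (incl (Nat.one_le_pow i.k (ℓ + 1) (Nat.succ_pos ℓ)) i.hsub x)
  rw [torusDeriv, torusDeriv, fld_tcovDeriv_mulVec_of_mem _ _ _ _ hx, fld_tcovDeriv_mulVec_of_mem _ _ _ _ hx']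
  rfl

/-- `δG_kf` evaluated: `(δG_kf)(x) = (G_k(Ω,A)f)(x) − (G_k(Ω₀,A)Ef)(x)`. [cite: Balaban1983RegularityDecay, (1.11) p.573] -/
theorem fld_deltaT (f : ↥(fineDom ((ℓ + 1) ^ i.k) i.ΩT) × ι → ℝ) (x : ↥(fineDom ((ℓ + 1) ^ i.k) i.ΩT)) :
    fld (i.deltaT F f) x = fld (i.GT F *ᵥ f) x - fld (i.G₀T F *ᵥ i.extT f) (incl (Nat.one_le_pow i.k (ℓ + 1) (Nat.succ_pos ℓ)) i.hsub x) := rfl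

/-- `D^η_{A,μ}δG_kf` on a torus bond of `Ω`: `(D_μG_k(Ω,A)f)(x) − (D_μG_k(Ω₀,A)Ef)(x)`. [cite: Balaban1983RegularityDecay, (1.3) p.572, (1.11) p.573] -/
theorem fld_DT_deltaT (μ : Fin (d + 1)) (f : ↥(fineDom ((ℓ + 1) ^ i.k) i.ΩT) × ι → ℝ)
    (x : ↥(fineDom ((ℓ + 1) ^ i.k) i.ΩT))
    (hx : twrap ((ℓ + 1) ^ i.k) i.P (x.1 + e1 μ) ∈ fineDom ((ℓ + 1) ^ i.k) i.ΩT) :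
    fld (i.DT F μ *ᵥ i.deltaT F f) x
      = fld (i.DT F μ *ᵥ (i.GT F *ᵥ f)) x - fld (i.D₀T F μ *ᵥ (i.G₀T F *ᵥ i.extT f)) (incl (Nat.one_le_pow i.k (ℓ + 1) (Nat.succ_pos ℓ)) i.hsub x) := by
  rw [← i.fld_DT_resT F μ _ x hx]
  show fld (i.DT F μ *ᵥ (i.GT F *ᵥ f - i.resT (i.G₀T F *ᵥ i.extT f))) x = _
  rw [Matrix.mulVec_sub]
  rfl

/-- off a torus bond of `Ω` the derivative vanishes (Neumann). [cite: Balaban1983RegularityDecay, (1.3) p.572, dictionary] -/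
theorem fld_DT_of_not_mem (μ : Fin (d + 1)) (v : ↥(fineDom ((ℓ + 1) ^ i.k) i.ΩT) × ι → ℝ)
    (x : ↥(fineDom ((ℓ + 1) ^ i.k) i.ΩT))
    (hx : twrap ((ℓ + 1) ^ i.k) i.P (x.1 + e1 μ) ∉ fineDom ((ℓ + 1) ^ i.k) i.ΩT) :
    fld (i.DT F μ *ᵥ v) x = 0 := by
  show fld (torusDeriv F i.e ((ℓ + 1) ^ i.k) i.P i.ΩT i.Ac μ *ᵥ v) x = 0
  rw [torusDeriv, fld_tcovDeriv_mulVec_of_not_mem _ _ _ _ hx]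

end TorusPairInst

/-! ## §3. Geometry of the lift: copy indices, far copies, torus distances of reductions, near and far sources -/

section Geometry

variable {n : ℕ} {P : Fin (d + 1) → ℕ}

omit [Fintype ι] [DecidableEq ι] in
/-- the copy index of a block is the fine coordinate divided by the fine period. [cite: Balaban1983RegularityDecay, (1.1) p.572, dictionary] -/
theorem cidx_blk (hn : 1 ≤ n) (x : Fin (d + 1) → ℤ) (ν : Fin (d + 1)) :
    cidx P (blk n x) ν = x ν / ((per n P ν : ℕ) : ℤ) := by
  have h0 : (0 : ℤ) ≤ n := by positivity
  show x ν / (n : ℤ) / (P ν : ℤ) = x ν / ((n * P ν : ℕ) : ℤ)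
  rw [Int.ediv_ediv_of_nonneg h0]
  push_cast
  rfl

omit [Fintype ι] [DecidableEq ι] in
/-- one-dimensional separation: a coordinate in copy `≤ t` (in absolute value) and one in a copy `≥ S+1` away differ by
more than `N(S − t)`. [cite: Balaban1983RegularityDecay, p.572 «periodic conditions», dictionary] -/
theorem per_mul_le_abs_sub {N : ℤ} (hN : 0 < N) {a b t S : ℤ} (ha : |a / N| ≤ t) (hb : S + 1 ≤ |b / N|) :
    N * (S - t) + 1 ≤ |a - b| := by
  have h1 := Int.mul_ediv_add_emod a N
  have h2 := Int.emod_nonneg a hN.ne'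
  have h3 := Int.emod_lt_of_pos a hN
  have h4 := Int.mul_ediv_add_emod b N
  have h5 := Int.emod_nonneg b hN.ne'
  have h6 := Int.emod_lt_of_pos b hN
  obtain ⟨ha1, ha2⟩ := abs_le.1 ha
  rcases le_abs'.1 hb with hb1 | hb1
  · have k1 : N * (b / N) ≤ N * (-(S + 1)) := mul_le_mul_of_nonneg_left hb1 hN.le
    have k2 : N * (-t) ≤ N * (a / N) := mul_le_mul_of_nonneg_left ha1 hN.le
    have k3 : N * (S - t) + 1 ≤ a - b := by linarith
    exact k3.trans (le_abs_self _)
  · have k1 : N * (S + 1) ≤ N * (b / N) := mul_le_mul_of_nonneg_left hb1 hN.le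
    have k2 : N * (a / N) ≤ N * t := mul_le_mul_of_nonneg_left ha2 hN.le
    have k3 : N * (S - t) + 1 ≤ -(a - b) := by linarith
    exact k3.trans (neg_le_abs _)

omit [Fintype ι] [DecidableEq ι] in
/-- **FAR COPIES ARE FAR**: a site whose block has all copy indices `≤ t` and a site whose block has some copy index
`> S` are at sup-distance `≥ n(S − t)`. [cite: Balaban1983RegularityDecay, p.572 «periodic conditions», dictionary] -/
theorem far_dist (hn : 1 ≤ n) (hP : ∀ ν, 1 ≤ P ν) {t S : ℕ} {x z : Fin (d + 1) → ℤ}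
    (hx : ∀ ν, |cidx P (blk n x) ν| ≤ t) (hz : ¬ ∀ ν, |cidx P (blk n z) ν| ≤ S) :
    ((S : ℝ) - t) * n ≤ supNorm (x - z) := by
  obtain ⟨ν, hν⟩ := not_forall.1 hz
  have hν' : (S : ℤ) + 1 ≤ |cidx P (blk n z) ν| := by have := not_le.1 hν; omega
  by_cases hSt : t ≤ S
  · have hN : (0 : ℤ) < ((per n P ν : ℕ) : ℤ) := by exact_mod_cast per_pos hn hP ν
    have hxν := hx ν
    rw [cidx_blk hn] at hxν hν'
    have key := per_mul_le_abs_sub hN hxν hν'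
    have hPn : (n : ℤ) ≤ ((per n P ν : ℕ) : ℤ) := by
      have hP1 : (1 : ℤ) ≤ (P ν : ℤ) := by exact_mod_cast hP ν
      have hn0 : (0 : ℤ) ≤ n := by positivity
      simp only [per]; push_cast; nlinarith
    have hSt' : (0 : ℤ) ≤ (S : ℤ) - t := by omega
    have h1 : (n : ℤ) * ((S : ℤ) - t) ≤ |x ν - z ν| := by
      have := mul_le_mul_of_nonneg_right hPn hSt'
      linarith
    calc ((S : ℝ) - t) * n = (((n : ℤ) * ((S : ℤ) - t) : ℤ) : ℝ) := by push_cast; ring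
      _ ≤ ((|x ν - z ν| : ℤ) : ℝ) := by exact_mod_cast h1
      _ = ((|(x - z) ν| : ℤ) : ℝ) := by rw [Pi.sub_apply]
      _ ≤ supNorm (x - z) := abs_le_supNorm _ _
  · have h1 : ((S : ℝ) - t) * n ≤ 0 := by
      have : (S : ℝ) < t := by exact_mod_cast not_le.1 hSt
      have hn' : (0 : ℝ) ≤ n := by positivity
      nlinarith
    exact h1.trans (supNorm_nonneg _)

omit [Fintype ι] [DecidableEq ι] in
/-- **TORUS DISTANCES ARE READ ON REDUCTIONS**: `|πx − πz|_T = |x − z|_T`. [cite: Balaban1983RegularityDecay, p.572 «periodic conditions», dictionary] -/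
theorem tnorm_twrap_sub_twrap (x z : Fin (d + 1) → ℤ) :
    tnorm n P (twrap n P x - twrap n P z) = tnorm n P (x - z) := by
  obtain ⟨s, hs⟩ := twrap_eq_add_per n P x
  obtain ⟨t, ht⟩ := twrap_eq_add_per n P z
  rw [hs, ht]
  have : ((x + fun ν => (per n P ν : ℤ) * s ν) - (z + fun ν => (per n P ν : ℤ) * t ν))
      = (x - z) + fun ν => (per n P ν : ℤ) * (s - t) ν := by
    funext ν; simp only [Pi.add_apply, Pi.sub_apply]; ring
  rw [this, tnorm_add_per]

omit [Fintype ι] [DecidableEq ι] in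
/-- a short residue is its own cyclic deviation: `2|r| < p ⇒ cdev_p(r) = |r|`. [cite: Balaban1983RegularityDecay, p.572 «periodic conditions», dictionary] -/
theorem cdev_eq_abs_of_small {p : ℕ} {r : ℤ} (h : 2 * |r| < p) : cdev p r = |r| := by
  unfold cdev
  rcases le_or_gt 0 r with hr | hr
  · rw [abs_of_nonneg hr] at h ⊢
    rw [Int.emod_eq_of_lt hr (by omega)]
    exact min_eq_left (by omega)
  · rw [abs_of_neg hr] at h ⊢
    have h1 : r % (p : ℤ) = r + p := by
      have e := Int.add_mul_emod_self_left r (p : ℤ) 1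
      rw [mul_one] at e
      rw [← e, Int.emod_eq_of_lt (by omega) (by omega)]
    rw [h1, show (p : ℤ) - (r + p) = -r by ring]
    exact min_eq_right (by omega)

omit [Fintype ι] [DecidableEq ι] in
/-- **SHORT VECTORS REALISE THEIR TORUS NORM**: `2|v_ν| < nP_ν` for all `ν` ⇒ `|v|_T = |v|_∞`. [cite: Balaban1983RegularityDecay, p.572 «periodic conditions», dictionary] -/
theorem tnorm_eq_supNorm_of_small {v : Fin (d + 1) → ℤ} (h : ∀ ν, 2 * |v ν| < per n P ν) :
    tnorm n P v = supNorm v := by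
  unfold tnorm supNorm
  congr 1
  funext ν
  show (((|cdev (per n P ν) (v ν)| : ℤ)) : ℝ) = _
  rw [cdev_eq_abs_of_small (h ν), abs_abs]

omit [Fintype ι] [DecidableEq ι] in
/-- a site within one fine period (coordinatewise) of a point of the period box lies in a copy of index `≤ 1`.
[cite: Balaban1983RegularityDecay, p.572 «periodic conditions», dictionary] -/
theorem abs_cidx_blk_le_one (hn : 1 ≤ n) (hP : ∀ ν, 1 ≤ P ν) {x z : Fin (d + 1) → ℤ} (hx : x ∈ boxDom (per n P))
    (hz : ∀ ν, |z ν - x ν| < per n P ν) : ∀ ν, |cidx P (blk n z) ν| ≤ 1 := by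
  intro ν
  rw [cidx_blk hn]
  have hN : (0 : ℤ) < ((per n P ν : ℕ) : ℤ) := by exact_mod_cast per_pos hn hP ν
  obtain ⟨hx0, hx1⟩ := mem_boxDom.1 hx ν
  have hzν := hz ν
  rw [abs_lt] at hzν
  rw [abs_le]
  constructor
  · rw [Int.le_ediv_iff_mul_le hN]; linarith
  · have h2 : z ν / ((per n P ν : ℕ) : ℤ) < 2 := by rw [Int.ediv_lt_iff_lt_mul hN]; linarith
    omega

/-- NEAR SITES: the block lies in a copy of index at most `S` in every direction. [cite: Balaban1983RegularityDecay, p.572 «periodic conditions», dictionary] -/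
def Near (n : ℕ) (P : Fin (d + 1) → ℕ) (S : ℕ) (x : Fin (d + 1) → ℤ) : Prop := ∀ ν, |cidx P (blk n x) ν| ≤ S

/-- nearness is decidable. [cite: Balaban1983RegularityDecay, p.572, dictionary] -/
instance Near.instDecidable (n : ℕ) (P : Fin (d + 1) → ℕ) (S : ℕ) (x : Fin (d + 1) → ℤ) : Decidable (Near n P S x) := by
  unfold Near; infer_instance

omit [Fintype ι] [DecidableEq ι] in
/-- sites over labels of the period box are in copy `0`. [cite: Balaban1983RegularityDecay, p.572 «periodic conditions», dictionary] -/
theorem near_zero_of_blk_mem {x : Fin (d + 1) → ℤ} (hx : blk n x ∈ boxDom P) : Near n P 0 x := by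
  intro ν; rw [cidx_of_mem_boxDom hx]; simp

omit [Fintype ι] [DecidableEq ι] in
/-- nearness is monotone in the radius. [cite: Balaban1983RegularityDecay, p.572, dictionary] -/
theorem Near.mono {S S' : ℕ} (h : S ≤ S') {x : Fin (d + 1) → ℤ} (hx : Near n P S x) : Near n P S' x :=
  fun ν => (hx ν).trans (by exact_mod_cast h)

omit [Fintype ι] [DecidableEq ι] in
/-- near sites are interior sites of a larger lift. [cite: Balaban1983RegularityDecay, p.572, dictionary] -/
theorem Near.isInt {S R : ℕ} (h : S + 1 ≤ R) {x : Fin (d + 1) → ℤ} (hx : Near n P S x) : IsInt n P R x := by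
  intro ν
  have := hx ν
  have h' : (S : ℤ) + 1 ≤ R := by exact_mod_cast h
  linarith

omit [Fintype ι] [DecidableEq ι] in
/-- a lattice neighbour of a site in copies `≤ S` is in copies `≤ S + 1`. [cite: Balaban1983RegularityDecay, p.572, dictionary] -/
theorem Near.of_nbrs (hn : 1 ≤ n) (hP : ∀ ν, 1 ≤ P ν) {S : ℕ} {x z : Fin (d + 1) → ℤ} (hx : Near n P S x)
    (hz : z ∈ nbrs x) : Near n P (S + 1) z := by
  intro ν
  have h1 : |blk n z ν - blk n x ν| ≤ 1 := abs_blk_sub_blk_le_of_nbrs hn hz ν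
  have hP0 : (0 : ℤ) < (P ν : ℤ) := by exact_mod_cast hP ν
  have h2 : |cidx P (blk n z) ν - cidx P (blk n x) ν| ≤ 1 := abs_ediv_sub_ediv_le hP0 h1
  have h3 := hx ν
  have h4 : |cidx P (blk n z) ν| ≤ |cidx P (blk n x) ν| + |cidx P (blk n z) ν - cidx P (blk n x) ν| := by
    have := abs_add_le (cidx P (blk n x) ν) (cidx P (blk n z) ν - cidx P (blk n x) ν)
    rwa [add_sub_cancel] at this
  push_cast
  linarith

omit [Fintype ι] [DecidableEq ι] in
/-- near sites belong to the lift when their reduction lies in the torus region. [cite: Balaban1983RegularityDecay, p.572, dictionary] -/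
theorem Near.mem_lift (hn : 1 ≤ n) (hP : ∀ ν, 1 ≤ P ν) {ΩT : Finset (Fin (d + 1) → ℤ)} (hΩ : ΩT ⊆ boxDom P)
    {S R : ℕ} (h : S ≤ R) {x : Fin (d + 1) → ℤ} (hx : Near n P S x) (hxT : twrap n P x ∈ fineDom n ΩT) :
    x ∈ fineDom n (liftLabels P R ΩT) :=
  (mem_fineDom_lift_iff hn hP hΩ).2 ⟨hxT, fun ν => (hx ν).trans (by exact_mod_cast h)⟩

variable (n P)

/-- THE NEAR PART of a source on a lift: the source on the blocks in copies `≤ S`, zero elsewhere.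
[cite: Balaban1983RegularityDecay, (1.9) p.573 «supp f», dictionary] -/
def cutNear (S : ℕ) {Ω' : Finset (Fin (d + 1) → ℤ)} (g : ↥(fineDom n Ω') × ι → ℝ) : ↥(fineDom n Ω') × ι → ℝ :=
  fun p => if Near n P S p.1.1 then g p else 0

variable {n P}

omit [Fintype ι] [DecidableEq ι] in
/-- the near part at a near site. [cite: Balaban1983RegularityDecay, (1.9) p.573, dictionary] -/
theorem cutNear_of_near {S : ℕ} {Ω' : Finset (Fin (d + 1) → ℤ)} (g : ↥(fineDom n Ω') × ι → ℝ)
    {p : ↥(fineDom n Ω') × ι} (hp : Near n P S p.1.1) : cutNear n P S g p = g p := by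
  simp only [cutNear, if_pos hp]

omit [Fintype ι] [DecidableEq ι] in
/-- the near part off the near sites. [cite: Balaban1983RegularityDecay, (1.9) p.573, dictionary] -/
theorem cutNear_of_not_near {S : ℕ} {Ω' : Finset (Fin (d + 1) → ℤ)} (g : ↥(fineDom n Ω') × ι → ℝ)
    {p : ↥(fineDom n Ω') × ι} (hp : ¬ Near n P S p.1.1) : cutNear n P S g p = 0 := by
  simp only [cutNear, if_neg hp]

omit [Fintype ι] [DecidableEq ι] in
/-- the near part at a site: the field's value or zero. [cite: Balaban1983RegularityDecay, (1.9) p.573, dictionary] -/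
theorem fld_cutNear {S : ℕ} {Ω' : Finset (Fin (d + 1) → ℤ)} (g : ↥(fineDom n Ω') × ι → ℝ) (z : ↥(fineDom n Ω')) :
    fld (cutNear n P S g) z = if Near n P S z.1 then fld g z else 0 := by
  funext j
  by_cases h : Near n P S z.1
  · rw [if_pos h]; exact cutNear_of_near g (p := (z, j)) h
  · rw [if_neg h]; exact cutNear_of_not_near g (p := (z, j)) h

omit [Fintype ι] [DecidableEq ι] in
/-- the far part at a site: zero or the field's value. [cite: Balaban1983RegularityDecay, (1.9) p.573, dictionary] -/
theorem fld_sub_cutNear {S : ℕ} {Ω' : Finset (Fin (d + 1) → ℤ)} (g : ↥(fineDom n Ω') × ι → ℝ)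
    (z : ↥(fineDom n Ω')) :
    fld (g - cutNear n P S g) z = if Near n P S z.1 then 0 else fld g z := by
  have h1 : fld (g - cutNear n P S g) z = fld g z - fld (cutNear n P S g) z := rfl
  rw [h1, fld_cutNear]
  split_ifs <;> simp

omit [DecidableEq ι] in
/-- `‖near part‖_∞ ≤ ‖g‖_∞`. [cite: Balaban1983RegularityDecay, (1.9) p.573 «‖f‖_∞», dictionary] -/
theorem supN_cutNear_le {S : ℕ} {Ω' : Finset (Fin (d + 1) → ℤ)} (g : ↥(fineDom n Ω') × ι → ℝ) :
    supN (cutNear n P S g) ≤ supN g :=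
  supN_le (supN_nonneg g) fun z => by
    rw [fld_cutNear]
    split_ifs
    · exact le_supN g z
    · rw [siteNorm_zero]; exact supN_nonneg g

omit [DecidableEq ι] in
/-- `‖far part‖_∞ ≤ ‖g‖_∞`. [cite: Balaban1983RegularityDecay, (1.9) p.573 «‖f‖_∞», dictionary] -/
theorem supN_sub_cutNear_le {S : ℕ} {Ω' : Finset (Fin (d + 1) → ℤ)} (g : ↥(fineDom n Ω') × ι → ℝ) :
    supN (g - cutNear n P S g) ≤ supN g :=
  supN_le (supN_nonneg g) fun z => by
    rw [fld_sub_cutNear]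
    split_ifs
    · rw [siteNorm_zero]; exact supN_nonneg g
    · exact le_supN g z

omit [Fintype ι] [DecidableEq ι] in
/-- two sources agreeing on the near sites have the same near part. [cite: Balaban1983RegularityDecay, (1.9) p.573, dictionary] -/
theorem cutNear_congr {S : ℕ} {Ω' : Finset (Fin (d + 1) → ℤ)} {g g' : ↥(fineDom n Ω') × ι → ℝ}
    (h : ∀ z : ↥(fineDom n Ω'), Near n P S z.1 → fld g z = fld g' z) : cutNear n P S g = cutNear n P S g' := by
  funext p
  by_cases hp : Near n P S p.1.1
  · rw [cutNear_of_near g hp, cutNear_of_near g' hp]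
    exact congrFun (h p.1 hp) p.2
  · rw [cutNear_of_not_near g hp, cutNear_of_not_near g' hp]

omit [Fintype ι] [DecidableEq ι] in
/-- the far part vanishes at near sites; a site where it does not vanish is not near. [cite: Balaban1983RegularityDecay, (1.9) p.573, dictionary] -/
theorem not_near_of_sub_cutNear_ne {S : ℕ} {Ω' : Finset (Fin (d + 1) → ℤ)} (g : ↥(fineDom n Ω') × ι → ℝ)
    {z : ↥(fineDom n Ω')} {j : ι} (h : (g - cutNear n P S g) (z, j) ≠ 0) : ¬ Near n P S z.1 := by
  intro hz
  apply h
  have := congrFun (fld_sub_cutNear (P := P) (S := S) g z) j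
  rw [if_pos hz] at this
  exact this

omit [Fintype ι] [DecidableEq ι] in
/-- a site where the near part does not vanish is near and carries the source. [cite: Balaban1983RegularityDecay, (1.9) p.573, dictionary] -/
theorem near_of_cutNear_ne {S : ℕ} {Ω' : Finset (Fin (d + 1) → ℤ)} (g : ↥(fineDom n Ω') × ι → ℝ)
    {z : ↥(fineDom n Ω')} {j : ι} (h : cutNear n P S g (z, j) ≠ 0) : Near n P S z.1 ∧ g (z, j) ≠ 0 := by
  by_cases hz : Near n P S z.1
  · rw [cutNear_of_near g (p := (z, j)) hz] at h
    exact ⟨hz, h⟩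
  · exact absurd (cutNear_of_not_near g (p := (z, j)) hz) h

end Geometry

/-! ## §4. Lifted contours -/

section Chains

variable (F : OrthFlow ι) {n : ℕ} (hn : 1 ≤ n) {P : Fin (d + 1) → ℕ} (hP : ∀ ν, 1 ≤ P ν) (h3 : ∀ ν, 3 ≤ per n P ν)
  {ΩT : Finset (Fin (d + 1) → ℤ)} (hΩ : ΩT ⊆ boxDom P) (R : ℕ)

/-- ONE LIFTED STEP: the lattice neighbour of `x̃` over the torus site `y` (if there is one; else `x̃`).
[cite: Balaban1983RegularityDecay, p.573 «a shortest contour», p.572 «periodic conditions», dictionary] -/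
def liftStep (xL : ↥(fineDom n (liftLabels P R ΩT))) (y : ↥(fineDom n ΩT)) : ↥(fineDom n (liftLabels P R ΩT)) :=
  open Classical in
  if h : ∃ zL : ↥(fineDom n (liftLabels P R ΩT)), zL.1 ∈ nbrs xL.1 ∧ proj hn hP hΩ R zL = y then h.choose else xL

/-- THE LIFTED CONTOUR: lift the torus chain step by step. [cite: Balaban1983RegularityDecay, p.573 «a shortest contour», dictionary] -/
def liftChain : ↥(fineDom n (liftLabels P R ΩT)) → List ↥(fineDom n ΩT) → List ↥(fineDom n (liftLabels P R ΩT))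
  | _, [] => []
  | xL, y :: l => liftStep hn hP hΩ R xL y :: liftChain (liftStep hn hP hΩ R xL y) l

omit [Fintype ι] [DecidableEq ι] in
/-- at an interior site the lifted step is a lattice neighbour over the prescribed torus neighbour.
[cite: Balaban1983RegularityDecay, p.572 «periodic conditions», dictionary] -/
theorem liftStep_spec {xL : ↥(fineDom n (liftLabels P R ΩT))} (hint : IsInt n P R xL.1) {y : ↥(fineDom n ΩT)}
    (hy : TNbr n P (proj hn hP hΩ R xL).1 y.1) :
    (liftStep hn hP hΩ R xL y).1 ∈ nbrs xL.1 ∧ proj hn hP hΩ R (liftStep hn hP hΩ R xL y) = y := by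
  classical
  have hex : ∃ zL : ↥(fineDom n (liftLabels P R ΩT)), zL.1 ∈ nbrs xL.1 ∧ proj hn hP hΩ R zL = y :=
    exists_nbr_lift hn hP hΩ R hint hy
  unfold liftStep
  rw [dif_pos hex]
  exact hex.choose_spec

omit [Fintype ι] [DecidableEq ι] in
/-- the lifted contour has the length of the torus contour. [cite: Balaban1983RegularityDecay, p.573, dictionary] -/
theorem liftChain_length : ∀ (l : List ↥(fineDom n ΩT)) (xL : ↥(fineDom n (liftLabels P R ΩT))),
    (liftChain hn hP hΩ R xL l).length = l.length
  | [], _ => rfl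
  | y :: l, xL => by
      show (liftChain hn hP hΩ R (liftStep hn hP hΩ R xL y) l).length + 1 = l.length + 1
      rw [liftChain_length l]

omit [Fintype ι] [DecidableEq ι] in
/-- the end point of a contour is its start or one of its listed sites. [cite: Balaban1983RegularityDecay, p.573, dictionary] -/
theorem pathEnd_eq_or_mem {X : Type} : ∀ (x : X) (l : List X), pathEnd x l = x ∨ pathEnd x l ∈ l
  | _, [] => Or.inl rfl
  | x, y :: l => by
      rcases pathEnd_eq_or_mem y l with h | h
      · exact Or.inr (by rw [pathEnd, h]; exact List.mem_cons_self)
      · exact Or.inr (by rw [pathEnd]; exact List.mem_cons_of_mem _ h)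

set_option maxHeartbeats 400000 in
include h3 in
/-- **THE LIFTED CONTOUR** of a torus nearest-neighbour chain from `πx̃`, started at an interior `x̃` in copies `≤ t`
with `t + |Γ| + 1 ≤ R`: a lattice nearest-neighbour chain projecting onto the torus chain, staying within `|Γ|` of
`x̃` in copies `≤ t + |Γ|`, with the same end-point reduction and THE SAME TRANSPORTER (the periodic field on the
lifted bonds is the torus field on the bonds). [cite: Balaban1983RegularityDecay, (1.4) p.572 «U(A(Γ))», p.573 «Γ_{x,x′}», p.572 «periodic conditions»] -/
theorem liftChain_spec (κ : ℝ) (Ac : (Fin (d + 1) → ℤ) → Fin (d + 1) → ℝ) :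
    ∀ (l : List ↥(fineDom n ΩT)) (xL : ↥(fineDom n (liftLabels P R ΩT))) (t : ℕ),
      Near n P t xL.1 → t + l.length + 1 ≤ R →
      PathRel (fun u v : ↥(fineDom n ΩT) => TNbr n P u.1 v.1) (proj hn hP hΩ R xL) l →
        IsNNChain xL (liftChain hn hP hΩ R xL l) ∧
        (liftChain hn hP hΩ R xL l).map (proj hn hP hΩ R) = l ∧
        proj hn hP hΩ R (pathEnd xL (liftChain hn hP hΩ R xL l)) = pathEnd (proj hn hP hΩ R xL) l ∧
        (∀ zL ∈ liftChain hn hP hΩ R xL l, Near n P (t + l.length) zL.1 ∧ supNorm (zL.1 - xL.1) ≤ l.length) ∧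
        transport (fieldLink F κ fun a b : ↥(fineDom n (liftLabels P R ΩT)) => compField (perField n P Ac) a.1 b.1)
            xL (liftChain hn hP hΩ R xL l)
          = transport (fieldLink F κ fun a b : ↥(fineDom n ΩT) => torBond n P Ac a.1 b.1) (proj hn hP hΩ R xL) l
  | [], xL, t, _, _, _ => by
      refine ⟨trivial, rfl, rfl, fun zL hz => ?_, rfl⟩
      simp [liftChain] at hz
  | y :: l, xL, t, hnear, hR, hpath => by
      have hint : IsInt n P R xL.1 := hnear.isInt (by simp at hR; omega)
      obtain ⟨hy, hpath'⟩ := hpath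
      obtain ⟨hnb, hproj⟩ := liftStep_spec hn hP hΩ R hint hy
      set yL := liftStep hn hP hΩ R xL y with hyL
      have hnear' : Near n P (t + 1) yL.1 := hnear.of_nbrs hn hP hnb
      have hR' : (t + 1) + l.length + 1 ≤ R := by simp at hR; omega
      have hpath'' : PathRel (fun u v : ↥(fineDom n ΩT) => TNbr n P u.1 v.1) (proj hn hP hΩ R yL) l := by
        rw [hproj]; exact hpath'
      obtain ⟨ih1, ih2, ih3, ih4, ih5⟩ := liftChain_spec κ Ac l yL (t + 1) hnear' hR' hpath''
      refine ⟨⟨hnb, ih1⟩, ?_, ?_, ?_, ?_⟩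
      · show proj hn hP hΩ R yL :: (liftChain hn hP hΩ R yL l).map (proj hn hP hΩ R) = y :: l
        rw [ih2, hproj]
      · show proj hn hP hΩ R (pathEnd yL (liftChain hn hP hΩ R yL l)) = pathEnd y l
        rw [ih3, hproj]
      · intro zL hz
        have hz' : zL = yL ∨ zL ∈ liftChain hn hP hΩ R yL l := by
          simpa [liftChain, ← hyL] using hz
        have hlen : ((y :: l).length : ℝ) = l.length + 1 := by push_cast [List.length_cons]; ring
        rcases hz' with hzeq | hz'
        · rw [hzeq]
          refine ⟨hnear'.mono (by simp), ?_⟩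
          rw [hlen]
          have h1 : supNorm (yL.1 - xL.1) ≤ 1 := by
            rw [← supNorm_neg, neg_sub]; exact supNorm_sub_le_one_of_mem_nbrs hnb
          have h2 : (0 : ℝ) ≤ l.length := Nat.cast_nonneg _
          linarith
        · obtain ⟨hz1, hz2⟩ := ih4 zL hz'
          refine ⟨fun ν => (hz1 ν).trans (by push_cast [List.length_cons]; linarith), ?_⟩
          rw [hlen]
          have h1 : supNorm (yL.1 - xL.1) ≤ 1 := by
            rw [← supNorm_neg, neg_sub]; exact supNorm_sub_le_one_of_mem_nbrs hnb
          have h2 : zL.1 - xL.1 = (zL.1 - yL.1) + (yL.1 - xL.1) := by abel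
          rw [h2]
          exact (supNorm_add_le _ _).trans (by linarith)
      · show fieldLink F κ (fun a b : ↥(fineDom n (liftLabels P R ΩT)) => compField (perField n P Ac) a.1 b.1) xL yL
            * transport (fieldLink F κ fun a b : ↥(fineDom n (liftLabels P R ΩT)) =>
                compField (perField n P Ac) a.1 b.1) yL (liftChain hn hP hΩ R yL l)
          = fieldLink F κ (fun a b : ↥(fineDom n ΩT) => torBond n P Ac a.1 b.1) (proj hn hP hΩ R xL) y
            * transport (fieldLink F κ fun a b : ↥(fineDom n ΩT) => torBond n P Ac a.1 b.1) y l
        rw [ih5, hproj]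
        congr 1
        show F.U (κ * compField (perField n P Ac) xL.1 yL.1) = F.U (κ * torBond n P Ac (proj hn hP hΩ R xL).1 y.1)
        rw [fieldLink_twrap_of_nbrs F κ h3 Ac hnb, ← hproj, proj_val, proj_val]

end Chains

end

end Literature.MathematicalPhysics.QuantumFieldTheory.Balaban1983to89.B4TorusPairFam
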